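import Summits.QuantumFields.YangMills.Theorems.FlatTubeReductionCoreDefectOrbitMomentSq
import Summits.QuantumFields.YangMills.Theorems.FlatTubeReductionOrbitWindowNumerology
import Summits.QuantumFields.YangMills.Theorems.LuscherReductionTwistedTraceScalingBODefectCoreRecord
import HarnessLib

/-!
# The integrated `(C4)`-core `L²` estimate with orbit-distance moment data — OF RECORD, general cap constant `Kc`

Support file for the crux `NearFlatRatioLaw` (line `ratepack_v2`, stub `stub_hODpot_A`, step (R4a) of
`Cruxes/NearFlatRatioLaw/Lines/ratepack-v7-moments-g18.md`).

The moment twin of `…BODefectCoreRecord.defect_core_record`: `…CoreDefectOrbitMomentSq.defect_core_sq_integral_le_orbit_moments` with the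
schedule-B data of record (cap-restricted stiff-Gaussian profile of radius `r_f = min(1/40, β^{-1/2}ℓ)`, core weight, stiff exponent,
fibre amplitude `c₁·stiffGaussTop·e^{-q}/I₀` with the central-quasimode rate `η_c = β^{-1/5}` of `…central_quasimode_rate`, the soft
gauge average of `recordChi` with (P) of `…fpWeight_core_constant`, the windows `d_O = D·β^{-s}`, `d_I = 14β^{-s}` measured by
`orbitDist`), eventually in `β` — the window / schedule hypotheses being discharged by
`…OrbitWindowNumerology.eventually_orbit_window_numerology`: `defect_core_sq_record_orbit_moments_K` — the same as
`…CoreDefectRecordOrbitMoments.defect_core_sq_record_orbit_moments` but with the cap constant `Kc ≥ 1` of `recordChi L s Kc M β` a parameter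
(the rate twin's stub uses `Kc = 42·max 1 (|Λ|/7) + 1` at `s = 1/6`, lane A's record uses `43`).  What then remains of
`stub_hODpot_A` is the evaluation of the right side (`…SlowSideAssembly.slow_side_le`, `…FibreFactorReweighted`, reference-moment
numbers) and the currency conversion.
-/

noncomputable section

open MeasureTheory Filter Topology Real
open scoped BigOperators
open Literature.MathematicalPhysics.QuantumFieldTheory
open Literature.MathematicalPhysics.QuantumLattice

namespace Summit.QuantumFields.YangMills.Theorems.FemtoTransferGap.TwoLattice.ConstTube

open Summit.QuantumFields.YangMills.Theorems.FemtoTransferGap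
open Summit.QuantumFields.YangMills.Theorems.FemtoTransferGap.TwoLattice
open Summit.QuantumFields.YangMills.Theorems.FemtoTransferGap.TwoLattice.Avg
open Summit.QuantumFields.YangMills.Theorems.FemtoTransferGap.TwoLattice.Stiff
open Summit.QuantumFields.YangMills.Theorems.FemtoTransferGap.TwoLattice.GnChart

variable {L : ℕ} [NeZero L]

set_option maxHeartbeats 1600000 in
-- explicit schedule-B data in the statement and an instantiation of `defect_core_sq_integral_le_orbit_moments` with ~10k-character arguments.
/-- ★★★ **THE (C4)-CORE `L²` ESTIMATE WITH MOMENT DATA, OF RECORD, GENERAL CAP CONSTANT** (see the module docstring). [cite: Luscher1983, §3] [cite: SjostrandZworski2007, §2] -/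
theorem defect_core_sq_record_orbit_moments_K (hL : Nonempty (NzSite L)) {s : ℝ} (hs : 0 < s) (hs3 : s ≤ 1 / 3) {Kc : ℝ} (hKc : 1 ≤ Kc) :
    ∃ M₀ : ℝ, 2 ≤ M₀ ∧ ∀ M : ℝ, M₀ ≤ M → ∀ D : ℝ, 0 ≤ D → ∃ (c₁ : ℝ → ℝ) (Cp : ℝ), 0 ≤ Cp ∧ ∀ᶠ β : ℝ in atTop, 0 < c₁ β ∧ (Cp * (Kc * powScale s β) ^ 2) < 1 ∧
      ∀ φ : GaugeConfig 3 1 SU2 → ℝ, Measurable φ → ∀ Cφ : ℝ, (∀ u, |φ u| ≤ Cφ) → (∀ u, φ u ≠ 0 → orbitDist u ≤ (14 * powScale s β)) →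
    ∫ U, {U : GaugeConfig 3 L SU2 | U ∈ orthoTubeSet L ∧ (recordChi L s Kc M β) U ≠ 0 ∧ ‖relLinkVec L U‖ ≤ ((min (1 / 40) (powScale (1 / 2) β * btLog β)) / 12) ∧ slowMean L U ∈ {u : GaugeConfig 3 1 SU2 | orbitDist u ≤ (D * powScale s β)}}.indicator (fun _ => (1 : ℝ)) U *
        ((((fpZ (powScale 1 β))⁻¹ * ∫ w, φ w * (∫ c, fpFibreTransfer L β (fun x : LinkSpace L => {x : LinkSpace L | linkCurry x ∈ capBalancedSet L}.indicator (fun _ => (1 : ℝ)) x * frozenProfile L (fun β' => stiffGaussExp L (β' / 2) β') (fun β' => min (1 / 40) (powScale (1 / 2) β' * btLog β')) β x) (coreWeight L (powScale 1 β) (5 * (powScale (1 / 2) β * btLog β ^ 2))) (gaugeTransform (fun _ : Site 3 L => c⁻¹) U) w ∂haarProbability SU2) ∂configMeasure SU2 1) / softWeight (recordChi L s Kc M β) U -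
            boFun L (fun u' => (fpZ (powScale 1 β))⁻¹ * (c₁ β * (stiffGaussTop L (β / 2) β / (∫ u, ({u : GaugeConfig 3 1 SU2 | (∀ k : Fin 3, ‖su2Quat (u (0, k)) - 1‖ ≤ (powScale (1 / 3) β)) ∧ (L : ℝ) ^ 3 * wilsonAction su2Rep u ≤ (powScale (1 / 2) β)}.indicator (fun _ => (1 : ℝ))) u * (transferKernel su2Rep ((L : ℝ) ^ 3 * β) (1 : GaugeConfig 3 1 SU2) u / transferKernel su2Rep ((L : ℝ) ^ 3 * β) (1 : GaugeConfig 3 1 SU2) 1) ∂configMeasure SU2 1))) / fpWeightBar L (powScale 1 β) * (∫ w, φ w * (avgKernel ((L : ℝ) ^ 3 * β) u' w / transferKernel su2Rep ((L : ℝ) ^ 3 * β) (1 : GaugeConfig 3 1 SU2) 1) ∂configMeasure SU2 1))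
              (fun x : LinkSpace L => {x : LinkSpace L | linkCurry x ∈ capBalancedSet L}.indicator (fun _ => (1 : ℝ)) x * frozenProfile L (fun β' => stiffGaussExp L (β' / 2) β') (fun β' => min (1 / 40) (powScale (1 / 2) β' * btLog β')) β x) U) ^ 2 *
          softWeight (recordChi L s Kc M β) U) ∂configMeasure SU2 L ≤
      2 * ((fpZ (powScale 1 β))⁻¹ ^ 2 * (c₁ β * (stiffGaussTop L (β / 2) β / (∫ u, ({u : GaugeConfig 3 1 SU2 | (∀ k : Fin 3, ‖su2Quat (u (0, k)) - 1‖ ≤ (powScale (1 / 3) β)) ∧ (L : ℝ) ^ 3 * wilsonAction su2Rep u ≤ (powScale (1 / 2) β)}.indicator (fun _ => (1 : ℝ))) u * (transferKernel su2Rep ((L : ℝ) ^ 3 * β) (1 : GaugeConfig 3 1 SU2) u / transferKernel su2Rep ((L : ℝ) ^ 3 * β) (1 : GaugeConfig 3 1 SU2) 1) ∂configMeasure SU2 1)))) / (fpWeightBar L (powScale 1 β) * (1 - (Cp * (Kc * powScale s β) ^ 2))) *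
          ∫ v, {v : Edge 3 L → Fin 3 → ℝ | ‖linkEmbed L v‖ ≤ ((min (1 / 40) (powScale (1 / 2) β * btLog β)) / 12)}.indicator (fun _ => (1 : ℝ)) v *
              (Real.exp (-(stiffGaussExp L (β / 2) β (linkEmbed L v))) * Real.exp (-(‖(gaugeModes L).starProjection (linkEmbed L v)‖ ^ 2 / powScale 1 β ^ 2))) *
            ∫ u, {u : GaugeConfig 3 1 SU2 | orbitDist u ≤ (D * powScale s β)}.indicator (fun _ => (1 : ℝ)) u *
              ((∫ w, φ w ^ 2 * (avgKernel ((L : ℝ) ^ 3 * β) u w / transferKernel su2Rep ((L : ℝ) ^ 3 * β) (1 : GaugeConfig 3 1 SU2) 1) ∂configMeasure SU2 1) *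
              (40 * (1 + powScale (1 / 5) β) *
                  ((∫ w, (216 * β * (orbitDist u + orbitDist w) * orbitDist u * (powScale 1 β * Fintype.card (Site 3 L)) +
                    300000000 * ((Fintype.card (Edge 3 L) : ℝ) + (Fintype.card (Plaquette 3 L × Fin 3) : ℝ) + (Fintype.card (Plaquette 3 L) : ℝ)) *
                        (β * ((4 + Real.sqrt (8 * (Fintype.card (Plaquette 3 1) : ℝ) * (L : ℝ) ^ 3)) * (orbitDist u + orbitDist w)) + Real.sqrt β / 2) * min (‖linkEmbed L v‖ ^ 2) (((min (1 / 40) (powScale (1 / 2) β * btLog β)) / 12) ^ 2) +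
                    3 * (300000000 * ((Fintype.card (Edge 3 L) : ℝ) + (Fintype.card (Plaquette 3 L × Fin 3) : ℝ) + (Fintype.card (Plaquette 3 L) : ℝ)) * (β + β * Real.sqrt β / 2)) * (min (‖linkEmbed L v‖ ^ 2) (((min (1 / 40) (powScale (1 / 2) β * btLog β)) / 12) ^ 2)) ^ 2) ^ 2 * (avgKernel ((L : ℝ) ^ 3 * β) u w / transferKernel su2Rep ((L : ℝ) ^ 3 * β) (1 : GaugeConfig 3 1 SU2) 1) ∂configMeasure SU2 1) *
                    (∫ c, fpFibreTransfer L β (fun x : LinkSpace L => {x : LinkSpace L | linkCurry x ∈ capBalancedSet L}.indicator (fun _ => (1 : ℝ)) x * frozenProfile L (fun β' => stiffGaussExp L (β' / 2) β') (fun β' => min (1 / 40) (powScale (1 / 2) β' * btLog β')) β x) (coreWeight L (powScale 1 β) (5 * (powScale (1 / 2) β * btLog β ^ 2))) (gaugeTransform (fun _ : Site 3 L => c⁻¹) (orthoTube L 1 v)) 1 ∂haarProbability SU2) +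
                  (∫ w, (300000000 * ((Fintype.card (Edge 3 L) : ℝ) + (Fintype.card (Plaquette 3 L × Fin 3) : ℝ) + (Fintype.card (Plaquette 3 L) : ℝ)) *
                        (β * ((4 + Real.sqrt (8 * (Fintype.card (Plaquette 3 1) : ℝ) * (L : ℝ) ^ 3)) * (orbitDist u + orbitDist w)) + Real.sqrt β / 2)) ^ 2 * (avgKernel ((L : ℝ) ^ 3 * β) u w / transferKernel su2Rep ((L : ℝ) ^ 3 * β) (1 : GaugeConfig 3 1 SU2) 1) ∂configMeasure SU2 1) *
                    ((∫ c, fpFibreTransfer L β (fun x => (fun x : LinkSpace L => {x : LinkSpace L | linkCurry x ∈ capBalancedSet L}.indicator (fun _ => (1 : ℝ)) x * frozenProfile L (fun β' => stiffGaussExp L (β' / 2) β') (fun β' => min (1 / 40) (powScale (1 / 2) β' * btLog β')) β x) x * (‖x‖ ^ 2) ^ 2) (coreWeight L (powScale 1 β) (5 * (powScale (1 / 2) β * btLog β ^ 2))) (gaugeTransform (fun _ : Site 3 L => c⁻¹) (orthoTube L 1 v)) 1 ∂haarProbability SU2) + (∫ c, fpFibreTransfer L β (fun x : LinkSpace L =>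 {x : LinkSpace L | linkCurry x ∈ capBalancedSet L}.indicator (fun _ => (1 : ℝ)) x * frozenProfile L (fun β' => stiffGaussExp L (β' / 2) β') (fun β' => min (1 / 40) (powScale (1 / 2) β' * btLog β')) β x) (fun g => (coreWeight L (powScale 1 β) (5 * (powScale (1 / 2) β * btLog β ^ 2))) g * (∑ x, ‖su2Quat (g x) - 1‖ ^ 2) ^ 2) (gaugeTransform (fun _ : Site 3 L => c⁻¹) (orthoTube L 1 v)) 1 ∂haarProbability SU2)) +
                  9 * (300000000 * ((Fintype.card (Edge 3 L) : ℝ) + (Fintype.card (Plaquette 3 L × Fin 3) : ℝ) + (Fintype.card (Plaquette 3 L) : ℝ)) * (β + β * Real.sqrt β / 2)) ^ 2 * (∫ w, (avgKernel ((L : ℝ) ^ 3 * β) u w / transferKernel su2Rep ((L : ℝ) ^ 3 * β) (1 : GaugeConfig 3 1 SU2) 1) ∂configMeasure SU2 1) *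
                    ((∫ c, fpFibreTransfer L β (fun x => (fun x : LinkSpace L => {x : LinkSpace L | linkCurry x ∈ capBalancedSet L}.indicator (fun _ => (1 : ℝ)) x * frozenProfile L (fun β' => stiffGaussExp L (β' / 2) β') (fun β' => min (1 / 40) (powScale (1 / 2) β' * btLog β')) β x) x * (‖x‖ ^ 2) ^ 4) (coreWeight L (powScale 1 β) (5 * (powScale (1 / 2) β * btLog β ^ 2))) (gaugeTransform (fun _ : Site 3 L => c⁻¹) (orthoTube L 1 v)) 1 ∂haarProbability SU2) + (∫ c, fpFibreTransfer L β (fun x : LinkSpace L => {x : LinkSpace L | linkCurry x ∈ capBalancedSet L}.indicator (fun _ => (1 : ℝ)) x * frozenProfile L (fun β' => stiffGaussExp L (β' / 2) β') (fun β' => min (1 / 40) (powScale (1 / 2) β' * btLog β')) β x) (fun g => (coreWeight L (powScale 1 β) (5 * (powScale (1 / 2) β * btLog β ^ 2))) g * (∑ x, ‖su2Quat (g x) - 1‖ ^ 2) ^ 4) (gaugeTransform (fun _ : Site 3 L => c⁻¹) (orthoTube L 1 v)) 1 ∂haarProbability SU2))) +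
                2 * powScale (1 / 5) β ^ 2 * (c₁ β * ((stiffGaussTop L (β / 2) β / (∫ u, ({u : GaugeConfig 3 1 SU2 | (∀ k : Fin 3, ‖su2Quat (u (0, k)) - 1‖ ≤ (powScale (1 / 3) β)) ∧ (L : ℝ) ^ 3 * wilsonAction su2Rep u ≤ (powScale (1 / 2) β)}.indicator (fun _ => (1 : ℝ))) u * (transferKernel su2Rep ((L : ℝ) ^ 3 * β) (1 : GaugeConfig 3 1 SU2) u / transferKernel su2Rep ((L : ℝ) ^ 3 * β) (1 : GaugeConfig 3 1 SU2) 1) ∂configMeasure SU2 1)) * Real.exp (-(stiffGaussExp L (β / 2) β (linkEmbed L v))))) * ∫ w, (avgKernel ((L : ℝ) ^ 3 * β) u w / transferKernel su2Rep ((L : ℝ) ^ 3 * β) (1 : GaugeConfig 3 1 SU2) 1) ∂configMeasure SU2 1)) ∂configMeasure SU2 1 ∂orthoTransverse L +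
        2 * ((fpZ (powScale 1 β))⁻¹ * (c₁ β * (stiffGaussTop L (β / 2) β / (∫ u, ({u : GaugeConfig 3 1 SU2 | (∀ k : Fin 3, ‖su2Quat (u (0, k)) - 1‖ ≤ (powScale (1 / 3) β)) ∧ (L : ℝ) ^ 3 * wilsonAction su2Rep u ≤ (powScale (1 / 2) β)}.indicator (fun _ => (1 : ℝ))) u * (transferKernel su2Rep ((L : ℝ) ^ 3 * β) (1 : GaugeConfig 3 1 SU2) u / transferKernel su2Rep ((L : ℝ) ^ 3 * β) (1 : GaugeConfig 3 1 SU2) 1) ∂configMeasure SU2 1))) * (Cp * (Kc * powScale s β) ^ 2)) ^ 2 / (fpWeightBar L (powScale 1 β) * (1 - (Cp * (Kc * powScale s β) ^ 2))) *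
          (∫ v, {v : Edge 3 L → Fin 3 → ℝ | ‖linkEmbed L v‖ ≤ ((min (1 / 40) (powScale (1 / 2) β * btLog β)) / 12)}.indicator (fun _ => (1 : ℝ)) v *
              (Real.exp (-(stiffGaussExp L (β / 2) β (linkEmbed L v))) ^ 2 * Real.exp (-(‖(gaugeModes L).starProjection (linkEmbed L v)‖ ^ 2 / powScale 1 β ^ 2))) ∂orthoTransverse L) *
          ∫ u, (∫ w, |φ w| * (avgKernel ((L : ℝ) ^ 3 * β) u w / transferKernel su2Rep ((L : ℝ) ^ 3 * β) (1 : GaugeConfig 3 1 SU2) 1) ∂configMeasure SU2 1) ^ 2 ∂configMeasure SU2 1 := by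
  -- (P) for the record weight (`δ = Kc·β^{-s}`, `δg = β^{-1}`)
  have hδ0 : ∀ β, 0 < (fun β : ℝ => Kc * powScale s β) β := fun β => mul_pos (by linarith) (powScale_pos _ _)
  have hδt : Tendsto (fun β : ℝ => Kc * powScale s β) atTop (𝓝 0) := by simpa using (tendsto_powScale (σ := s) hs).const_mul Kc
  have hsd : ∀ᶠ β in atTop, 0 < powScale 1 β ∧ powScale 1 β ≤ (fun β : ℝ => Kc * powScale s β) β ^ 3 := by
    filter_upwards [eventually_ge_atTop (1 : ℝ)] with β hβ
    refine ⟨powScale_pos _ _, ?_⟩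
    have h1 : powScale 1 β ≤ powScale s β ^ 3 := powScale_one_le_cube hs3 hβ
    have h2 : powScale s β ^ 3 ≤ (Kc * powScale s β) ^ 3 :=
      pow_le_pow_left₀ (powScale_pos _ _).le (le_mul_of_one_le_left (powScale_pos _ _).le hKc) 3
    exact h1.trans h2
  obtain ⟨M₀, hM₀, hPM⟩ := fpWeight_core_constant L hL hδ0 hδt hsd
  refine ⟨M₀, hM₀, fun M hM D hD => ?_⟩
  obtain ⟨c₁, hquasi⟩ := central_quasimode_rate (L := L) hL
  obtain ⟨Cp, β₀, hCp, hP⟩ := hPM M hM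
  refine ⟨c₁, Cp, hCp, ?_⟩
  have eκ : ∀ᶠ β : ℝ in atTop, (Cp * (Kc * powScale s β) ^ 2) < 1 := by
    have h := ((tendsto_powScale (σ := s) hs).const_mul Kc).pow 2 |>.const_mul Cp
    rw [mul_zero, zero_pow two_ne_zero, mul_zero] at h
    exact h.eventually (eventually_lt_nhds one_pos)
  have e37 : ∀ᶠ β : ℝ in atTop, (min (1 / 40) (powScale (1 / 2) β * btLog β)) ≤ (9 * (L : ℝ) * (5 * (powScale (1 / 2) β * btLog β ^ 2)) + (powScale 1 β)) ∧
      3 * L * (5 * (powScale (1 / 2) β * btLog β ^ 2)) < 1 := by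
    have h3 := eventually_mul_lt_of_tendsto (tendsto_powScale_mul_btLog_pow (p := 1 / 2) (by norm_num) 2) (3 * (L : ℝ) * 5) one_pos
    filter_upwards [h3] with β h
    refine ⟨rf_le_schedT (L := L) β, ?_⟩
    calc 3 * L * (5 * (powScale (1 / 2) β * btLog β ^ 2)) = (3 * (L : ℝ) * 5) * (powScale (1 / 2) β * btLog β ^ 2) := by ring
      _ < 1 := h
  have enum := eventually_orbit_window_numerology (L := L) hs hD
  filter_upwards [hquasi, eventually_ge_atTop β₀, eκ, e37, enum, eventually_ge_atTop (1 : ℝ)] with β hQ hβ0 hκ1 h37 hnum hβ1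
  obtain ⟨hc₁, hC1⟩ := hQ
  obtain ⟨hdO, hd1, hσ, hS900, hH1⟩ := hnum
  refine ⟨hc₁, hκ1, fun φ hφm Cφ hφb hφs => ?_⟩
  have hβp : (0 : ℝ) < β := by linarith
  have hZ : 0 < fpZ (powScale 1 β) := fpZ_pos (powScale_pos 1 β)
  have hZi : 0 ≤ (fpZ (powScale 1 β))⁻¹ := (inv_pos.2 hZ).le
  have hI0 := slowWindow_I0_pos (L := L) (powScale_pos (1 / 3) β) (powScale_pos (1 / 2) β) ((L : ℝ) ^ 3 * β)
  obtain ⟨hSlo, -⟩ := stiffGaussTop_record_bounds (L := L) hβp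
  have hS : 0 < stiffGaussTop L (β / 2) β := lt_of_lt_of_le (pow_pos (Real.sqrt_pos.2 (by positivity)) _) hSlo
  have ha₀' : 0 ≤ stiffGaussTop L (β / 2) β / (∫ u, ({u : GaugeConfig 3 1 SU2 | (∀ k : Fin 3, ‖su2Quat (u (0, k)) - 1‖ ≤ (powScale (1 / 3) β)) ∧ (L : ℝ) ^ 3 * wilsonAction su2Rep u ≤ (powScale (1 / 2) β)}.indicator (fun _ => (1 : ℝ))) u * (transferKernel su2Rep ((L : ℝ) ^ 3 * β) (1 : GaugeConfig 3 1 SU2) u / transferKernel su2Rep ((L : ℝ) ^ 3 * β) (1 : GaugeConfig 3 1 SU2) 1) ∂configMeasure SU2 1) :=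
    (div_pos hS hI0).le
  have hNbar := fpWeightBar_pos L (powScale_pos 1 β)
  have hκ0 : 0 ≤ (Cp * (Kc * powScale s β) ^ 2) := by positivity
  have hNκ : 0 < (fpWeightBar L (powScale 1 β)) * (1 - (Cp * (Kc * powScale s β) ^ 2)) := mul_pos hNbar (by linarith)
  have hx0 : 0 < powScale (1 / 2) β := powScale_pos _ _
  have hℓ0 : 0 ≤ btLog β := le_trans zero_le_one (one_le_btLog β)
  have hrf0 : 0 ≤ (min (1 / 40) (powScale (1 / 2) β * btLog β)) := le_min (by norm_num) (mul_nonneg hx0.le hℓ0)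
  -- (P) on the fat tube
  have hPF : ∀ U ∈ (fatTubeRho L (fun β => Kc * powScale s β) (fun b => M * (Kc * powScale s b)) β),
      (fpWeightBar L (powScale 1 β)) * (1 - (Cp * (Kc * powScale s β) ^ 2)) ≤ gaugeAvg (recordChi L s Kc M β) U ∧
        gaugeAvg (recordChi L s Kc M β) U ≤ (fpWeightBar L (powScale 1 β)) * (1 + (Cp * (Kc * powScale s β) ^ 2)) :=
    fun U hU => hP β hβ0 U hU
  -- the data
  have hqfm : ∀ β', Measurable ((fun β'' : ℝ => stiffGaussExp L (β'' / 2) β'') β') := fun β' => measurable_stiffGaussExp _ _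
  have hqf0 : ∀ β' x, 0 ≤ (fun β'' : ℝ => stiffGaussExp L (β'' / 2) β'') β' x := fun β' x => stiffGaussExp_nonneg _ _ x
  have hΩGm : Measurable (frozenProfile L (fun β' => stiffGaussExp L (β' / 2) β') (fun β' => min (1 / 40) (powScale (1 / 2) β' * btLog β')) β) :=
    measurable_frozenProfile hqfm _ β
  have hΩG0 : ∀ x, 0 ≤ frozenProfile L (fun β' => stiffGaussExp L (β' / 2) β') (fun β' => min (1 / 40) (powScale (1 / 2) β' * btLog β')) β x :=
    fun x => (frozenProfile_mem_Icc hqf0 _ β x).1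
  have hΩG1 : ∀ x, |frozenProfile L (fun β' => stiffGaussExp L (β' / 2) β') (fun β' => min (1 / 40) (powScale (1 / 2) β' * btLog β')) β x| ≤ 1 := abs_frozenProfile_le hqf0 _ β
  have hΩm := measurable_capRestrict (L := L) hΩGm
  have hΩdat := fun x => capRestrict_mem (L := L) hΩG0 hΩG1 x
  have hΩt : ∀ v : Edge 3 L → Fin 3 → ℝ, (fun x : LinkSpace L => {x : LinkSpace L | linkCurry x ∈ capBalancedSet L}.indicator (fun _ => (1 : ℝ)) x *
      frozenProfile L (fun β' => stiffGaussExp L (β' / 2) β') (fun β' => min (1 / 40) (powScale (1 / 2) β' * btLog β')) β x) (linkEmbed L v) ≠ 0 →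
      v ∈ capBalancedSet L ∧ ‖linkEmbed L v‖ ≤ (min (1 / 40) (powScale (1 / 2) β * btLog β)) := fun v hv => by
    obtain ⟨hcap, -, hvn⟩ := capRestrict_frozenProfile_support (L := L) _ _ β v hv
    exact ⟨hcap, hvn⟩
  have hWm := measurable_coreWeight (L := L) (powScale 1 β) (5 * (powScale (1 / 2) β * btLog β ^ 2))
  have hWc := fun g (hg : coreWeight L (powScale 1 β) (5 * (powScale (1 / 2) β * btLog β ^ 2)) g ≠ 0) => coreWeight_support (L := L) (powScale_pos 1 β).le h37.2 hg
  have hRinT : (min (1 / 40) (powScale (1 / 2) β * btLog β)) / 12 ≤ (9 * (L : ℝ) * (5 * (powScale (1 / 2) β * btLog β ^ 2)) + powScale 1 β) :=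
    (div_le_self hrf0 (by norm_num)).trans h37.1
  have hRin : (min (1 / 40) (powScale (1 / 2) β * btLog β)) / 12 ≤ (fun β' : ℝ => min (1 / 40) (powScale (1 / 2) β' * btLog β')) β := div_le_self hrf0 (by norm_num)
  have hΓ0 : 0 ≤ powScale 1 β * (Fintype.card (Site 3 L) : ℝ) := mul_nonneg (powScale_pos _ _).le (Nat.cast_nonneg _)
  -- the central quasimode rate in the form `c_q · (a₀' · e^{-q})`
  have eP : ∀ x : LinkSpace L, c₁ β * ((stiffGaussTop L (β / 2) β * Real.exp (-stiffGaussExp L (β / 2) β x)) /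
      (∫ u, ({u : GaugeConfig 3 1 SU2 | (∀ k : Fin 3, ‖su2Quat (u (0, k)) - 1‖ ≤ (powScale (1 / 3) β)) ∧ (L : ℝ) ^ 3 * wilsonAction su2Rep u ≤ (powScale (1 / 2) β)}.indicator (fun _ => (1 : ℝ))) u * (transferKernel su2Rep ((L : ℝ) ^ 3 * β) (1 : GaugeConfig 3 1 SU2) u / transferKernel su2Rep ((L : ℝ) ^ 3 * β) (1 : GaugeConfig 3 1 SU2) 1) ∂configMeasure SU2 1)) =
      c₁ β * (stiffGaussTop L (β / 2) β / (∫ u, ({u : GaugeConfig 3 1 SU2 | (∀ k : Fin 3, ‖su2Quat (u (0, k)) - 1‖ ≤ (powScale (1 / 3) β)) ∧ (L : ℝ) ^ 3 * wilsonAction su2Rep u ≤ (powScale (1 / 2) β)}.indicator (fun _ => (1 : ℝ))) u * (transferKernel su2Rep ((L : ℝ) ^ 3 * β) (1 : GaugeConfig 3 1 SU2) u / transferKernel su2Rep ((L : ℝ) ^ 3 * β) (1 : GaugeConfig 3 1 SU2) 1) ∂configMeasure SU2 1) *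
        Real.exp (-((fun β'' : ℝ => stiffGaussExp L (β'' / 2) β'') β x))) := fun x => by
    dsimp only; rw [mul_div_right_comm]
  have hC1' := fun v'' (h1 : v'' ∈ capBalancedSet L) (h2 : ∀ (e : Edge 3 L) (a : Fin 3), |v'' e a| ≤ (9 * (L : ℝ) * (5 * (powScale (1 / 2) β * btLog β ^ 2)) + powScale 1 β))
      (h3 : ‖linkEmbed L v''‖ ≤ (min (1 / 40) (powScale (1 / 2) β * btLog β)) / 12) => by
    have h := hC1 v'' h1 h2 h3
    rw [eP (linkEmbed L v'')] at h
    exact h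
  have main := defect_core_sq_integral_le_orbit_moments (L := L) hβ1 (measurableSet_fatTubeRho L _ _ β) (recordChi_eq_indicator_mul (L := L) s Kc M β) hNκ hκ0 hPF
    (q := fun β' => stiffGaussExp L (β' / 2) β') hqfm (fun x => stiffGaussExp_nonneg _ _ x) (fun g x => by simp only [stiffGaussExp_adL])
    (fun β' => min (1 / 40) (powScale (1 / 2) β' * btLog β')) hΩm (fun x => (hΩdat x).2.2) (fun x => (hΩdat x).1) hWm
    (abs_coreWeight_le (L := L) _ _) (fun g => (coreWeight_mem_Icc (L := L) _ _ g).1)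
    (dO := D * powScale s β) (dI := 14 * powScale s β) (c₂ := 300000000 * ((Fintype.card (Edge 3 L) : ℝ) + (Fintype.card (Plaquette 3 L × Fin 3) : ℝ) + (Fintype.card (Plaquette 3 L) : ℝ)) * (β + β * Real.sqrt β / 2))
    hdO (mul_nonneg (by norm_num) (powScale_pos _ _).le) hd1 hσ hRinT hRin hΓ0 hΩt hWc
    (cq := c₁ β) (ηc := powScale (1 / 5) β) (Zi := (fpZ (powScale 1 β))⁻¹) hc₁.le ha₀' (powScale_pos _ _).le hZi hC1' hS900 le_rfl hH1 hφm hφb hφs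
  exact main

end Summit.QuantumFields.YangMills.Theorems.FemtoTransferGap.TwoLattice.ConstTube

end
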